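import Summits.QuantumFields.YangMills.Theorems.AllWindowsColdBoxBoxHighLineTiltUMomentsPrelims
import Summits.QuantumFields.YangMills.Theorems.AllWindowsColdBoxBoxHighLineLandauDivergence
import Summits.QuantumFields.YangMills.Theorems.AllWindowsColdBoxBoxHighLinePhiTaylor
import Summits.QuantumFields.YangMills.Theorems.AllWindowsColdBoxBoxHighLineBoxQuadFormFloor

/-!
# The `Φ⁴` vertex `phiQuartic`: local monomial form at an interior site, polynomial certificate, measurability, sup on the small field
# (inputs of the K3′ row «E1-Φ» of the hK3 row-sum — planner ym-idea-2 g18's ruling 2026-08-30T01:19:49Z ★FLAG-1; `Cruxes/BoxWindowHighSU2213/ASSEMBLY-U5.md` §8;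
#  LINE-20 U5 ⟨stmt-QuantumFields-24336⟩)

Width seat `ym-line-sfw-p2-w2` (g33).  The quartic Taylor term of the gauge-fixing functional in the edge chart (✓`phiTaylor`, clause 3),
`phiQuartic H a = −(1/3) Σ_{x interior} Σ_c (d*a)_x^c · (d*(‖a‖²a))_x^c`, enters the tilt exponent as `−β·phiQuartic`; its sup×L² row fails in the HIGH
window (fcl-p3 g27's Q8 table, row (c): `[11θ − 1/2]`), so the hK3 row-sum needs the EXACT connected row `κ₃(L_x, L_y; −β·phiQuartic)` (files
`…PhiQuarticMoments`, `…K3PrimeRowE1Phi`).  This file: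

* `divLin_eq_sum_signed`, ★ `phiSite_eq_sum_monomials` — at an interior site `x` the site term `−(1/3) Σ_c divLin·divLin(cubeField)` is a sum over the
  finite index `Fin 3 × (Fin 4 ⊕ Fin 4) × (Fin 4 ⊕ Fin 4) × Fin 3` of `−(1/3)σ_kσ_{k'}` times a quartic MONOMIAL whose four legs sit on the eight edges at `x`
  (✓`gradVec_dotProduct_eq_interior`), i.e. within sup-distance `1` of `x` (`abs_signedEdge_base_sub_le_one`) — the shape consumed by w3 g41's
  ✓`WickPairCubic.abs_gaussAvg_centredLandauForms_mul_four_connected_le`;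
* `polyCert_divLin`, `GaussNormalForm.polyCert_normSq`, `polyCert_divLin_cubeField`, `polyCert_phiQuartic` / `polyCert_phiSite` (degree `4`), `measurable_phiQuartic`;
* `abs_divLin_le_of_mem_smallField` (`8s`, `8s³`), ★ `abs_phiQuartic_le_of_mem_smallField` — `|phiQuartic H a| ≤ 1024·H⁴·s⁴` on `smallField H s`.

Tree only; no definitions; standard axioms.  HONEST LABEL: U5 prep, helper-grade (inputs of ONE K3′ row); U5 ⟨24336⟩ UNSTAFFED/OPEN, ⟨24004⟩ OPEN; route
AllWindowsColdBox DRAFT; no crux, rung or summit is proved; **the Yang–Mills mass gap is NOT proved by this file; no summit is proved by a line.**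
-/

set_option autoImplicit false

noncomputable section

open MeasureTheory Matrix Finset
open Literature.Probability.LatticeModels (Site)

namespace Summit.QuantumFields.YangMills.Theorems.AllWindowsColdBoxBoxHighLine

namespace PhiQuartic

open EdgeChartGaussian (polyCert_const polyCert_coord polyCert_sub polyCert_mul polyCert_pow polyCert_sum polyCert_const_mul
  gaussAvg_sq_mul_sq_le_of_polyCert integrable_polyCert_mul_gaussWeight)
open LaplaceSandwich (flatten)

variable {H : ℕ}

/-! ## §1 The site terms of `phiQuartic` and their local monomial form -/

/-- `phiQuartic` is the sum of its site terms. -/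
theorem phiQuartic_eq_sum_sites (H : ℕ) (a : LandauFree H → E3) :
    phiQuartic H a = ∑ x ∈ interiorSites H, -(1 / 3 : ℝ) * ∑ c : Fin 3, divLin H x a c * divLin H x (cubeField a) c := by
  rw [phiQuartic, Finset.mul_sum]

/-- Components of the cubed field: `(‖a_e‖² a_e)^c = ‖a_e‖²·a_e^c`. -/
theorem cubeField_apply (a : LandauFree H → E3) (e : LandauFree H) (c : Fin 3) : cubeField a e c = ‖a e‖ ^ 2 * a e c := by
  simp [cubeField]

/-- `divLin` as a plain sum over the free edges. -/
theorem divLin_eq_sum (x : Site 4) (f : LandauFree H → E3) (c : Fin 3) : divLin H x f c = ∑ e, gradVec H x e * f e c := rfl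

/-- **At an interior site the divergence is a signed sum over the eight edges at `x`** (in-edges `+`, out-edges `−`). -/
theorem divLin_eq_sum_signed {x : Site 4} (hx : x ∈ interiorSites H) (f : LandauFree H → E3) (c : Fin 3) :
    divLin H x f c = ∑ k : Fin 4 ⊕ Fin 4, Sum.elim (fun _ => (1 : ℝ)) (fun _ => -1) k * f (Sum.elim (inEdge hx) (outEdge hx) k) c := by
  rw [divLin, gradVec_dotProduct_eq_interior hx, Fintype.sum_sum_type]
  simp only [colour, Sum.elim_inl, Sum.elim_inr, one_mul, neg_one_mul, Finset.sum_neg_distrib, sub_eq_add_neg]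

/-- The base point of each of the eight edges at an interior site `x` is within sup-distance `1` of `x`. -/
theorem abs_signedEdge_base_sub_le_one {x : Site 4} (hx : x ∈ interiorSites H) (k : Fin 4 ⊕ Fin 4) (m : Fin 4) :
    |((((Sum.elim (inEdge hx) (outEdge hx) k).1.1.1 m - x m : ℤ)) : ℝ)| ≤ 1 := by
  rcases k with μ | μ
  · have h : ((Sum.elim (inEdge hx) (outEdge hx) (Sum.inl μ)).1.1.1 : Site 4) = x - Pi.single μ 1 := rfl
    rw [h, Pi.sub_apply, Pi.single_apply]
    split_ifs <;> push_cast <;> ring_nf <;> norm_num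
  · have h : ((Sum.elim (inEdge hx) (outEdge hx) (Sum.inr μ)).1.1.1 : Site 4) = x := rfl
    rw [h, sub_self]; norm_num

/-- A generic rearrangement: `(Σ_k u_k)·(Σ_{k'} (Σ_{c'} r_{k'c'})·v_{k'}) = Σ_k Σ_{k'} Σ_{c'} u_k·(r_{k'c'}·v_{k'})`. -/
theorem sum_mul_sum_sum_mul {K C : Type*} [Fintype K] [Fintype C] (u v : K → ℝ) (r : K → C → ℝ) :
    (∑ k : K, u k) * (∑ k' : K, (∑ c' : C, r k' c') * v k') = ∑ k : K, ∑ k' : K, ∑ c' : C, u k * (r k' c' * v k') := by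
  rw [Finset.sum_mul_sum]
  refine Finset.sum_congr rfl fun k _ => Finset.sum_congr rfl fun k' _ => ?_
  rw [Finset.sum_mul, Finset.mul_sum]

/-- ★ **Local monomial form of the site term**: at an interior site `x`,
`−(1/3) Σ_c divLin_x(a)^c · divLin_x(‖a‖²a)^c = Σ_{(c,k,k',c')} (−(1/3)σ_kσ_{k'}) · a_{E_k}^c a_{E_{k'}}^c a_{E_{k'}}^{c'} a_{E_{k'}}^{c'}`
with `E = (in-edges, out-edges)` and signs `σ = (+1, −1)`. -/
theorem phiSite_eq_sum_monomials {x : Site 4} (hx : x ∈ interiorSites H) (a : LandauFree H → E3) :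
    -(1 / 3 : ℝ) * ∑ c : Fin 3, divLin H x a c * divLin H x (cubeField a) c =
      ∑ i : Fin 3 × (Fin 4 ⊕ Fin 4) × (Fin 4 ⊕ Fin 4) × Fin 3,
        (-(1 / 3 : ℝ) * (Sum.elim (fun _ => (1 : ℝ)) (fun _ => -1) i.2.1 * Sum.elim (fun _ => (1 : ℝ)) (fun _ => -1) i.2.2.1)) *
          (a (Sum.elim (inEdge hx) (outEdge hx) i.2.1) i.1 * a (Sum.elim (inEdge hx) (outEdge hx) i.2.2.1) i.1 *
            (a (Sum.elim (inEdge hx) (outEdge hx) i.2.2.1) i.2.2.2 * a (Sum.elim (inEdge hx) (outEdge hx) i.2.2.1) i.2.2.2)) := by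
  simp only [Fintype.sum_prod_type]
  rw [Finset.mul_sum]
  refine Finset.sum_congr rfl fun c _ => ?_
  have h3 : ∀ k' : Fin 4 ⊕ Fin 4, Sum.elim (fun _ => (1 : ℝ)) (fun _ => -1) k' * cubeField a (Sum.elim (inEdge hx) (outEdge hx) k') c =
      (∑ c' : Fin 3, a (Sum.elim (inEdge hx) (outEdge hx) k') c' ^ 2) *
        (Sum.elim (fun _ => (1 : ℝ)) (fun _ => -1) k' * a (Sum.elim (inEdge hx) (outEdge hx) k') c) := by
    intro k'
    rw [cubeField_apply, BoxQuadForm.norm_sq_eq_sum]; ring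
  rw [divLin_eq_sum_signed hx, divLin_eq_sum_signed hx (cubeField a)]
  simp_rw [h3]
  rw [sum_mul_sum_sum_mul, Finset.mul_sum]
  refine Finset.sum_congr rfl fun k _ => ?_
  rw [Finset.mul_sum]
  refine Finset.sum_congr rfl fun k' _ => ?_
  rw [Finset.mul_sum]
  refine Finset.sum_congr rfl fun c' _ => ?_
  ring

/-! ## §2 Polynomial certificates and measurability -/

/-- `divLin_x(a)^c` has degree `≤ 1`. -/
theorem polyCert_divLin (x : Site 4) (c : Fin 3) :
    ∃ Q : MvPolynomial (LandauFree H × Fin 3) ℝ, Q.totalDegree ≤ 1 ∧ ∀ a : LandauFree H → E3,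
      divLin H x a c = MvPolynomial.eval (flatten (LandauFree H) a) Q :=
  polyCert_sum _ fun e _ => polyCert_const_mul (gradVec H x e) (polyCert_coord e c le_rfl)

/-- `divLin_x(‖a‖²a)^c` has degree `≤ 3`. -/
theorem polyCert_divLin_cubeField (x : Site 4) (c : Fin 3) :
    ∃ Q : MvPolynomial (LandauFree H × Fin 3) ℝ, Q.totalDegree ≤ 3 ∧ ∀ a : LandauFree H → E3,
      divLin H x (cubeField a) c = MvPolynomial.eval (flatten (LandauFree H) a) Q := by
  obtain ⟨Q, hQ, h⟩ := polyCert_sum (Finset.univ : Finset (LandauFree H)) (d := 3)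
    (F := fun e (a : LandauFree H → E3) => gradVec H x e * (‖a e‖ ^ 2 * a e c))
    fun e _ => polyCert_const_mul (gradVec H x e) (polyCert_mul (GaussNormalForm.polyCert_normSq e) (polyCert_coord e c le_rfl))
  exact ⟨Q, hQ, fun a => by rw [divLin_eq_sum]; simp_rw [cubeField_apply]; exact h a⟩

/-- ★ `phiQuartic` has degree `≤ 4`. -/
theorem polyCert_phiQuartic (H : ℕ) :
    ∃ Q : MvPolynomial (LandauFree H × Fin 3) ℝ, Q.totalDegree ≤ 4 ∧ ∀ a : LandauFree H → E3,
      phiQuartic H a = MvPolynomial.eval (flatten (LandauFree H) a) Q :=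
  polyCert_const_mul _ (polyCert_sum _ fun x _ => polyCert_sum _ fun c _ => polyCert_mul (polyCert_divLin x c) (polyCert_divLin_cubeField x c))

/-- The site term has degree `≤ 4`. -/
theorem polyCert_phiSite (x : Site 4) :
    ∃ Q : MvPolynomial (LandauFree H × Fin 3) ℝ, Q.totalDegree ≤ 4 ∧ ∀ a : LandauFree H → E3,
      -(1 / 3 : ℝ) * ∑ c : Fin 3, divLin H x a c * divLin H x (cubeField a) c = MvPolynomial.eval (flatten (LandauFree H) a) Q :=
  polyCert_const_mul _ (polyCert_sum _ fun c _ => polyCert_mul (polyCert_divLin x c) (polyCert_divLin_cubeField x c))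

/-- A certified polynomial chart observable is measurable (as in ✓`EdgeChartGaussian.measurable_of_polyCert`, restated import-free). -/
theorem measurable_of_polyCert' {F : (LandauFree H → E3) → ℝ} {d : ℕ}
    (hF : ∃ Q : MvPolynomial (LandauFree H × Fin 3) ℝ, Q.totalDegree ≤ d ∧ ∀ a, F a = MvPolynomial.eval (flatten (LandauFree H) a) Q) :
    Measurable F := by
  obtain ⟨Q, -, hQ⟩ := hF
  rw [show F = fun a => MvPolynomial.eval (flatten (LandauFree H) a) Q from funext hQ]
  exact (MvPolynomial.continuous_eval Q).measurable.comp (flatten (LandauFree H)).measurable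

/-- `phiQuartic` is measurable. -/
theorem measurable_phiQuartic (H : ℕ) : Measurable (phiQuartic H) := measurable_of_polyCert' (polyCert_phiQuartic H)

/-! ## §3 Sup on the small field -/

/-- On `smallField H s`: `|divLin_x(a)^c| ≤ 8s` and `|divLin_x(‖a‖²a)^c| ≤ 8s³` at interior sites. -/
theorem abs_divLin_le_of_mem_smallField {x : Site 4} (hx : x ∈ interiorSites H) {s : ℝ} {a : LandauFree H → E3}
    (ha : a ∈ smallField H s) (c : Fin 3) : |divLin H x a c| ≤ 8 * s ∧ |divLin H x (cubeField a) c| ≤ 8 * s ^ 3 := by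
  have habs : ∀ (v : E3) (c : Fin 3), |v c| ≤ ‖v‖ := fun v c => by have h := PiLp.norm_apply_le v c; rwa [Real.norm_eq_abs] at h
  have h1 : ∀ k : Fin 4 ⊕ Fin 4, |Sum.elim (fun _ => (1 : ℝ)) (fun _ => -1) k * a (Sum.elim (inEdge hx) (outEdge hx) k) c| ≤ s := by
    intro k
    rw [abs_mul]
    have hσ : |Sum.elim (fun _ => (1 : ℝ)) (fun _ => -1) k| = 1 := by rcases k with μ | μ <;> simp
    rw [hσ, one_mul]
    exact (habs _ c).trans (ha _)
  have h3 : ∀ k : Fin 4 ⊕ Fin 4, |Sum.elim (fun _ => (1 : ℝ)) (fun _ => -1) k * cubeField a (Sum.elim (inEdge hx) (outEdge hx) k) c| ≤ s ^ 3 := by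
    intro k
    have hσ : |Sum.elim (fun _ => (1 : ℝ)) (fun _ => -1) k| = 1 := by rcases k with μ | μ <;> simp
    rw [abs_mul, hσ, one_mul, cubeField_apply, abs_mul, abs_of_nonneg (sq_nonneg ‖a (Sum.elim (inEdge hx) (outEdge hx) k)‖)]
    have hn := ha (Sum.elim (inEdge hx) (outEdge hx) k)
    have hc := (habs (a (Sum.elim (inEdge hx) (outEdge hx) k)) c).trans hn
    calc ‖a (Sum.elim (inEdge hx) (outEdge hx) k)‖ ^ 2 * |a (Sum.elim (inEdge hx) (outEdge hx) k) c| ≤ s ^ 2 * s :=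
          mul_le_mul (pow_le_pow_left₀ (norm_nonneg _) hn 2) hc (abs_nonneg _) (sq_nonneg _)
      _ = s ^ 3 := by ring
  have hcard : ((Finset.univ : Finset (Fin 4 ⊕ Fin 4)).card : ℝ) = 8 := by simp
  constructor
  · rw [divLin_eq_sum_signed hx]
    refine (Finset.abs_sum_le_sum_abs _ _).trans ?_
    calc ∑ k : Fin 4 ⊕ Fin 4, |Sum.elim (fun _ => (1 : ℝ)) (fun _ => -1) k * a (Sum.elim (inEdge hx) (outEdge hx) k) c|
        ≤ ∑ _k : Fin 4 ⊕ Fin 4, s := Finset.sum_le_sum fun k _ => h1 k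
      _ = 8 * s := by rw [Finset.sum_const, nsmul_eq_mul, hcard]
  · rw [divLin_eq_sum_signed hx]
    refine (Finset.abs_sum_le_sum_abs _ _).trans ?_
    calc ∑ k : Fin 4 ⊕ Fin 4, |Sum.elim (fun _ => (1 : ℝ)) (fun _ => -1) k * cubeField a (Sum.elim (inEdge hx) (outEdge hx) k) c|
        ≤ ∑ _k : Fin 4 ⊕ Fin 4, s ^ 3 := Finset.sum_le_sum fun k _ => h3 k
      _ = 8 * s ^ 3 := by rw [Finset.sum_const, nsmul_eq_mul, hcard]

/-- ★ **Sup of `phiQuartic` on the small field**: `|phiQuartic H a| ≤ 1024·H⁴·s⁴` for `a ∈ smallField H s`. -/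
theorem abs_phiQuartic_le_of_mem_smallField (H : ℕ) {s : ℝ} {a : LandauFree H → E3} (ha : a ∈ smallField H s) :
    |phiQuartic H a| ≤ 1024 * (H : ℝ) ^ 4 * s ^ 4 := by
  have hsite : ∀ x ∈ interiorSites H, |-(1 / 3 : ℝ) * ∑ c : Fin 3, divLin H x a c * divLin H x (cubeField a) c| ≤ 64 * s ^ 4 := by
    intro x hx
    rw [abs_mul, show |-(1 / 3 : ℝ)| = 1 / 3 by norm_num]
    have h : |∑ c : Fin 3, divLin H x a c * divLin H x (cubeField a) c| ≤ 3 * (8 * s * (8 * s ^ 3)) := by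
      refine (Finset.abs_sum_le_sum_abs _ _).trans ?_
      calc ∑ c : Fin 3, |divLin H x a c * divLin H x (cubeField a) c| ≤ ∑ _c : Fin 3, 8 * s * (8 * s ^ 3) :=
            Finset.sum_le_sum fun c _ => by
              rw [abs_mul]
              have h := abs_divLin_le_of_mem_smallField hx ha c
              exact mul_le_mul h.1 h.2 (abs_nonneg _) (by linarith [(abs_nonneg _).trans h.1])
        _ = 3 * (8 * s * (8 * s ^ 3)) := by simp
    calc 1 / 3 * |∑ c : Fin 3, divLin H x a c * divLin H x (cubeField a) c| ≤ 1 / 3 * (3 * (8 * s * (8 * s ^ 3))) :=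
          mul_le_mul_of_nonneg_left h (by norm_num)
      _ = 64 * s ^ 4 := by ring
  rw [phiQuartic_eq_sum_sites]
  refine (Finset.abs_sum_le_sum_abs _ _).trans ((Finset.sum_le_sum hsite).trans ?_)
  rw [Finset.sum_const, nsmul_eq_mul]
  have hc := PhiTaylorProof.card_interiorSites_le H
  have hs4 : 0 ≤ 64 * s ^ 4 := by positivity
  nlinarith

end PhiQuartic

end Summit.QuantumFields.YangMills.Theorems.AllWindowsColdBoxBoxHighLine
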